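import Summits.CriticalPhenomena.PercolationContinuityZ3.Theorems.PercNearOneGluingNoHeavyLowerTailHullPortTADefs
import HarnessLib

/-!
# `NoHeavyLowerTail` (stmt-CriticalPhenomena-4575) — the OWNER-SET `T_A` functionals (definitions)

Definitions file (prover `prim-hp-7`; `--supports stmt-CriticalPhenomena-4575`).  prim-hp-8's proof of `(S5)_r` for
every `r` (cell memo PROOF-S5-ALL-R.md; ⟹ GEN for every relay set ⟹ Kozma–Nitzan's Conjecture 1 for all `|A|` ⟹ crux
stmt-4576 `AdditiveGluing`) needs, besides tree theorems, the inequality (Htw) = the diagonal of its (K9):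
`Σ_W μ(C_Y = W)·(p_W − p)·H_{G−W}(v) ≥ 0`, `H_{G−W}(v) = Cov_{G−W}(g(C_x), 1{v ↔ S})` for an owner SET `S ∋ x`.
This is prim-hp-7's functional `T_A` (cell memo HP7-MDLX-PROOF §0; tree: `HullPort.taC … taQ` of `…HullPortTADefs`)
with the connection event `{s ↔ y}` replaced by `{v ↔ S}` (cell memo HP7-HTW-PROOF.md).  Same bookkeeping as
`…HullPortTADefs` (sum level, `BHK2006.weight`, `delE`, `cut`, `avoidEv`): with `K̄ = cut X ω`,
`connS S v = {v ↔ S}`, `taCS` (`Cov_{G−K̄}(g(C_x), 1{v ↔ S})`), `taNS` (`μ_{G−K̄}(v ↮ S)`), `taNWS`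
(`μ_{G−K̄}(v ↮ S, v ↔ o)`), `taBS = Σ_ω w 1_{x↮X} c`, `taAS = Σ_ω w 1_{x↮X} (taNWS/taNS) c`, `tabS = μ(v ↮ S ∪ X)`,
`taaS = μ(v ↮ S ∪ X, v ↔ o)`, `taQS = taAS·tabS − taaS·taBS` (`= b·T^S`).  At `S = {x}` these are the `T_A` functionals
with `(s, y, z) = (x, v, o)`.
[cite: VandenbergHaggstromKahn2005, §1 pp. 3–5 (induced model on `G − Z`) — bookkeeping]
-/

noncomputable section

namespace Summit.CriticalPhenomena.PercolationContinuityZ3.Theorems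

open MeasureTheory Set Literature.Probability.LatticeModels Literature.Probability.Percolation
open scoped Classical

variable {V : Type*}

namespace HullPort

open BHK2006 DecisionTree

section TAS

variable [Fintype V]

/-- `{v ↔ S}`: the vertex `v` is joined by an open path to some vertex of the set `S`. [folklore] -/
def connS (S : Set V) (v : V) : Set (Set (Sym2 V)) := {ω | ∃ u ∈ S, (openGraph ω).Reachable v u}

/-- `c(ω) = Cov_{G − cut_X(ω)}(g(C_x), 1{v ↔ S})` (the memo's `H_W(v)`, `W = C_X(ω)`).
(transcription of the cell memo prim-hp-7 HP7-HTW-PROOF.md §0) [folklore] -/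
def taCS (w : Sym2 V → ℝ) (x : V) (S : Set V) (v : V) (X : Set V) (g : Set (Sym2 V) → ℝ)
    (ω : Set (Sym2 V)) : ℝ :=
  delE w (cut X ω) (fun η => g (openEdgeCluster η x) * ind (connS S v) η) -
    delE w (cut X ω) (fun η => g (openEdgeCluster η x)) * delE w (cut X ω) (ind (connS S v))

/-- `μ_{G − cut_X(ω)}(v ↮ S)` (the memo's `b_W`). [folklore] -/
def taNS (w : Sym2 V → ℝ) (S : Set V) (v : V) (X : Set V) (ω : Set (Sym2 V)) : ℝ :=
  delE w (cut X ω) (ind (connS S v : Set (Set (Sym2 V)))ᶜ)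

/-- `μ_{G − cut_X(ω)}(v ↮ S, v ↔ o)` (the memo's `a_W`). [folklore] -/
def taNWS (w : Sym2 V → ℝ) (S : Set V) (v o : V) (X : Set V) (ω : Set (Sym2 V)) : ℝ :=
  delE w (cut X ω) (ind ((connS S v : Set (Set (Sym2 V)))ᶜ ∩ openConn v o))

/-- `B = Σ_W m(W) H_W = Σ_ω w(ω) 1{x ↮ X} c(ω)`. (transcription of the cell memo prim-hp-7 HP7-HTW-PROOF.md §1) [folklore] -/
def taBS (w : Sym2 V → ℝ) (x : V) (S : Set V) (v : V) (X : Set V) (g : Set (Sym2 V) → ℝ) : ℝ :=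
  ∑ ω, weight w ω * (ind (avoidEv x X) ω * taCS w x S v X g ω)

/-- `A = Σ_W m(W) p_W H_W = Σ_ω w(ω) 1{x ↮ X} (taNWS/taNS)(ω) c(ω)`. (transcription of the cell memo prim-hp-7
HP7-HTW-PROOF.md §1) [folklore] -/
def taAS (w : Sym2 V → ℝ) (x : V) (S : Set V) (v o : V) (X : Set V) (g : Set (Sym2 V) → ℝ) : ℝ :=
  ∑ ω, weight w ω * (ind (avoidEv x X) ω * (taNWS w S v o X ω / taNS w S v X ω * taCS w x S v X g ω))

/-- `b = μ(v ↮ S ∪ X)`. [folklore] -/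
def tabS (w : Sym2 V → ℝ) (S : Set V) (v : V) (X : Set V) : ℝ := ∑ ω, weight w ω * ind (avoidEv v (S ∪ X)) ω

/-- `a = μ(v ↮ S ∪ X, v ↔ o)`. [folklore] -/
def taaS (w : Sym2 V → ℝ) (S : Set V) (v o : V) (X : Set V) : ℝ :=
  ∑ ω, weight w ω * ind (avoidEv v (S ∪ X) ∩ openConn v o) ω

/-- `Q = A·b − a·B` (`= b · T^S` of the memo). (transcription of the cell memo prim-hp-7 HP7-HTW-PROOF.md §1, (F1^S))
[folklore] -/
def taQS (w : Sym2 V → ℝ) (x : V) (S : Set V) (v o : V) (X : Set V) (g : Set (Sym2 V) → ℝ) : ℝ :=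
  taAS w x S v o X g * tabS w S v X - taaS w S v o X * taBS w x S v X g

end TAS

end HullPort

end Summit.CriticalPhenomena.PercolationContinuityZ3.Theorems
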